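import Literature.RingTheory.FittingIdeal.FittingLemma
import Mathlib.LinearAlgebra.TensorProduct.RightExactness
import Mathlib.LinearAlgebra.TensorProduct.Pi
import Mathlib.LinearAlgebra.TensorProduct.Tower
import Mathlib.RingTheory.Finiteness.Defs
import HarnessLib

/-!
# Fitting ideals: generating sets of relations, and base change (Stacks 07Z6, 07ZA (3))

Topic: `Literature/RingTheory/FittingIdeal`. Companion to `FittingLemma.lean` (Fitting's lemma for
the intrinsic `Module.fittingIdeal` of `Basic.lean`). Two working consequences, both PROVED:

* `Module.fittingIdeal_eq_span_det_of_relations` — **`Fitt_k` from a generating SET of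
  relations** (Stacks 07Z6 with an arbitrary, possibly infinite, presentation
  `⨁_{κ ∈ K} R → R^n → M → 0`): if `x₁, …, xₙ` generate `M` and `K` is a set of relations among
  them spanning the relation module, then `Fitt_k(M)` is generated by the `(n - k) × (n - k)`
  minors of matrices whose rows are taken from `K` (multilinearity of the determinant in the
  rows, each row being a finite combination of elements of `K`);
* `Module.fittingIdeal_baseChange` — **Stacks 07ZA (3): "If `M` is finite, then
  `Fitt_k(M ⊗_R R') = Fitt_k(M) R'`"** (Eisenbud Cor. 20.5: "the formation of Fitting ideals
  commutes with base change"), for every `R`-algebra `S` and finite `R`-module `M`: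
  `Fitt_k(S ⊗_R M) = Fitt_k(M) S`. Proof: `1 ⊗ xᵢ` generate `S ⊗ M`; by right exactness of
  `S ⊗_R -` (`lTensor_exact`) applied to `K → R^n → M → 0`, transported along
  `S ⊗_R R^n ≅ S^n` (`TensorProduct.piScalarRight`), the relations among the `1 ⊗ xᵢ` are the
  `S`-span of the images of the relations among the `xᵢ`
  (`Module.relation_baseChange_mem_span`); conclude by the previous theorem and
  `det ∘ algebraMap = algebraMap ∘ det`. (The inclusion `Fitt_k(M) S ⊆ Fitt_k(S ⊗ M)`, which
  does not need Fitting's lemma, is also `Module.map_fittingIdeal_le_baseChange` of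
  `Functoriality.lean`; the equality is what computations use.)

In particular Fitting ideals commute with localisation and with passing to `R/I ⊗ M = M/IM`,
and with completion `R̂ ⊗ M` — the compatibilities by which de Jong 1996, 2.21/3.3 reads the
scheme `Sing(f) = V(Fitt₁ Ω_{X/S})` on complete local rings.

## Sources

* The Stacks Project, Tag 07Z6, Tag 07ZA (3). [StacksProject]
* D. Eisenbud, *Commutative Algebra with a View Toward Algebraic Geometry*, GTM 150 (1995),
  §20.2, Cor. 20.5. [Eisenbud1995]
-/

namespace Literature.RingTheory.FittingIdeal

universe u v w

open Matrix TensorProduct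

variable {R : Type u} [CommRing R] {M : Type v} [AddCommGroup M] [Module R M]

/-! ## `Fitt_k` from a generating set of relations -/

/-- **`Fitt_k(M)` from a generating SET of relations** (Stacks 07Z6 for an arbitrary
presentation): if `x₁, …, xₙ` generate `M`, `K` is a set of relations among them
(`∑ κₗ xₗ = 0`) and every relation is an `R`-combination of elements of `K`, then `Fitt_k(M)` is
the ideal generated by the `(n - k) × (n - k)` minors `det (κᵢ (σ i'))` of matrices with rows
`κ₁, …, κ_{n-k} ∈ K`. By Fitting's lemma (`Module.fittingIdeal_eq_relMinorIdeal`) and the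
multilinearity of the determinant in the rows: a row `ρᵢ = ∑ₜ fᵢₜ κᵢₜ` expands `det` into
`∑_r (∏ᵢ f_{i, r i}) det (κ_{i, r i} (σ i'))`. [cite: StacksProject, Tag 07Z6] -/
theorem Module.fittingIdeal_eq_span_det_of_relations {n : ℕ} (x : Fin n → M)
    (hx : Submodule.span R (Set.range x) = ⊤) (K : Set (Fin n → R))
    (hK : ∀ κ ∈ K, ∑ l, κ l • x l = 0)
    (hgen : ∀ ρ : Fin n → R, ∑ l, ρ l • x l = 0 → ρ ∈ Submodule.span R K) (k : ℕ) :
    Module.fittingIdeal R M k = Ideal.span {d : R | ∃ (κ : Fin (n - k) → Fin n → R)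
      (σ : Fin (n - k) → Fin n), (∀ i, κ i ∈ K) ∧ d = Matrix.det (Matrix.of fun i i' => κ i (σ i'))} := by
  rw [Module.fittingIdeal_eq_relMinorIdeal x hx k]
  apply le_antisymm
  · rw [Module.relMinorIdeal_le_iff]
    intro ρ σ hρ
    -- each row is a finite combination of elements of `K`
    have hrow := fun i => Submodule.mem_span_set'.1 (hgen (ρ i) (hρ i))
    choose N f g hfg using hrow
    -- multilinear expansion in the rows, with row `i` indexed by `Fin (N i)`
    have hX : (Matrix.of fun i i' => ρ i (σ i')) =
        Matrix.of (fun i => ∑ t : Fin (N i), f i t • fun i' => (g i t : Fin n → R) (σ i')) := by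
      ext i i'
      simp only [Matrix.of_apply, Finset.sum_apply, Pi.smul_apply, smul_eq_mul]
      rw [← hfg i]
      simp only [Finset.sum_apply, Pi.smul_apply, smul_eq_mul]
    have hsum := MultilinearMap.map_sum
      (Matrix.detRowAlternating : (Fin (n - k) → R) [⋀^Fin (n - k)]→ₗ[R] R).toMultilinearMap
      (fun i (t : Fin (N i)) => f i t • fun i' => (g i t : Fin n → R) (σ i'))
    simp only [AlternatingMap.coe_multilinearMap, MultilinearMap.map_smul_univ] at hsum
    rw [hX]
    change Matrix.detRowAlternating
      (fun i => ∑ t : Fin (N i), f i t • fun i' => (g i t : Fin n → R) (σ i')) ∈ _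
    rw [hsum]
    refine Submodule.sum_mem _ (fun r _ => ?_)
    rw [smul_eq_mul]
    refine Ideal.mul_mem_left _ _ (Ideal.subset_span ⟨fun i => (g i (r i) : Fin n → R), σ,
      fun i => (g i (r i)).2, ?_⟩)
    rfl
  · refine Ideal.span_le.2 ?_
    rintro d ⟨κ, σ, hκ, rfl⟩
    exact Module.det_mem_relMinorIdeal x κ (fun i => hK _ (hκ i)) σ

/-! ## Base change -/

section BaseChange

variable (S : Type w) [CommRing S] [Algebra R S]

/-- The images in `S^n` of the relations of `x` are relations of the base-changed family
`1 ⊗ x₁, …, 1 ⊗ xₙ` of `S ⊗_R M`. [folklore] -/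
theorem Module.isRelation_baseChange {n : ℕ} (x : Fin n → M) {κ : Fin n → R}
    (hκ : ∑ l, κ l • x l = 0) :
    ∑ l, algebraMap R S (κ l) • ((1 : S) ⊗ₜ[R] x l) = 0 := by
  have h : ∀ l, algebraMap R S (κ l) • ((1 : S) ⊗ₜ[R] x l) = (1 : S) ⊗ₜ[R] (κ l • x l) := by
    intro l
    rw [algebraMap_smul, TensorProduct.smul_tmul', TensorProduct.smul_tmul]
  simp only [h, ← TensorProduct.tmul_sum, hκ, TensorProduct.tmul_zero]

/-- **Right exactness: the relations of `1 ⊗ x` are spanned by the relations of `x`.** If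
`x₁, …, xₙ` generate `M`, every relation `∑ ρ'ₗ (1 ⊗ xₗ) = 0` in `S ⊗_R M` with `ρ' ∈ S^n` is
an `S`-linear combination of images of relations of `x` in `R^n`: tensor the exact
`K → R^n → M → 0` with `S` (`lTensor_exact`) and transport along `S ⊗_R R^n ≅ S^n`
(`TensorProduct.piScalarRight`). [cite: StacksProject, Tag 07ZA] -/
theorem Module.relation_baseChange_mem_span {n : ℕ} (x : Fin n → M)
    (hx : Submodule.span R (Set.range x) = ⊤) {ρ' : Fin n → S}
    (hρ' : ∑ l, ρ' l • ((1 : S) ⊗ₜ[R] x l) = 0) :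
    ρ' ∈ Submodule.span S
      ((fun κ : Fin n → R => fun l => algebraMap R S (κ l)) '' {κ | ∑ l, κ l • x l = 0}) := by
  classical
  -- the presentation `K → R^n → M → 0`
  set g : (Fin n → R) →ₗ[R] M := Fintype.linearCombination R x with hg
  set K : Submodule R (Fin n → R) := LinearMap.ker g with hK
  have hexact : Function.Exact K.subtype g := g.exact_subtype_ker_map
  have hsurj : Function.Surjective g := by
    rw [← LinearMap.range_eq_top, hg, Fintype.range_linearCombination, hx]
  have hT := lTensor_exact S hexact hsurj
  -- the element of `S ⊗ R^n` corresponding to `ρ'`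
  set φ : S ⊗[R] (Fin n → R) ≃ₗ[S] (Fin n → S) := TensorProduct.piScalarRight R S S (Fin n) with hφ
  set z : S ⊗[R] (Fin n → R) := φ.symm ρ' with hz
  have hρ'sum : ρ' = ∑ l, Pi.single l (ρ' l) := (Finset.univ_sum_single ρ').symm
  have hz' : z = ∑ l, ρ' l ⊗ₜ[R] Pi.single l (1 : R) := by
    rw [hz, hρ'sum, map_sum]
    simp only [hφ, TensorProduct.piScalarRight_symm_single]
    rw [← hρ'sum]
  -- it lies in the kernel of `S ⊗ g`
  have hzker : LinearMap.lTensor S g z = 0 := by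
    rw [hz', map_sum]
    have h : ∀ l, LinearMap.lTensor S g (ρ' l ⊗ₜ[R] Pi.single l (1 : R)) =
        ρ' l • ((1 : S) ⊗ₜ[R] x l) := fun l => by
      rw [LinearMap.lTensor_tmul, hg, Fintype.linearCombination_apply_single, one_smul,
        TensorProduct.smul_tmul', smul_eq_mul, mul_one]
    simp only [h, hρ']
  -- hence in the image of `S ⊗ K`, which is the `S`-span of the `1 ⊗ κ`, `κ ∈ K`
  obtain ⟨w, hw⟩ := (hT z).1 hzker
  have hzmem : z ∈ K.baseChange S := by
    rw [Submodule.baseChange, ← hw]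
    exact ⟨w, by rw [LinearMap.baseChange_eq_ltensor]⟩
  rw [Submodule.baseChange_eq_span] at hzmem
  -- transport along `φ`
  have hρ'z : ρ' = φ z := by rw [hz, LinearEquiv.apply_symm_apply]
  rw [hρ'z]
  have hmap : Submodule.map (φ : S ⊗[R] (Fin n → R) →ₗ[S] (Fin n → S))
      (Submodule.span S (K.map (TensorProduct.mk R S (Fin n → R) 1) : Set (S ⊗[R] (Fin n → R)))) ≤
      Submodule.span S
        ((fun κ : Fin n → R => fun l => algebraMap R S (κ l)) '' {κ | ∑ l, κ l • x l = 0}) := by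
    rw [Submodule.map_span, Submodule.span_le]
    rintro _ ⟨_, ⟨κ, hκ, rfl⟩, rfl⟩
    refine Submodule.subset_span ⟨κ, ?_, ?_⟩
    · have hκ' : g κ = 0 := hκ
      rw [hg, Fintype.linearCombination_apply] at hκ'
      exact hκ'
    · funext l
      simp [hφ, TensorProduct.piScalarRightHom_tmul, Algebra.algebraMap_eq_smul_one]
  exact hmap (Submodule.mem_map_of_mem hzmem)

/-- **Stacks 07ZA (3) / Eisenbud Cor. 20.5 — Fitting ideals commute with base change**: for a
finite `R`-module `M` and any `R`-algebra `S`, `Fitt_k(S ⊗_R M) = Fitt_k(M)·S` ("If `M` is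
finite, then `Fitt_k(M ⊗_R R') = Fitt_k(M) R'`"). The family `1 ⊗ xᵢ` generates `S ⊗ M`, its
relations are spanned by the images of the relations of the `xᵢ`
(`Module.relation_baseChange_mem_span`), so by `Module.fittingIdeal_eq_span_det_of_relations`
its Fitting ideals are generated by the images `algebraMap (det (κᵢ (σ i')))` of the relation
minors of `x`. In particular Fitting ideals commute with localisation, completion `R̂ ⊗_R -`
of finite modules over a Noetherian local ring, and reduction modulo an ideal.
[cite: StacksProject, Tag 07ZA] -/
theorem Module.fittingIdeal_baseChange [Module.Finite R M] (k : ℕ) :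
    Module.fittingIdeal S (S ⊗[R] M) k = (Module.fittingIdeal R M k).map (algebraMap R S) := by
  classical
  obtain ⟨n, x, hx⟩ := Module.Finite.exists_fin (R := R) (M := M)
  -- the base-changed generating family
  set y : Fin n → S ⊗[R] M := fun i => (1 : S) ⊗ₜ[R] x i with hy_def
  have hy : Submodule.span S (Set.range y) = ⊤ := by
    have h := Submodule.baseChange_span (R := R) (M := M) (A := S) (Set.range x)
    rw [hx, Submodule.baseChange_top] at h
    have hr : Set.range y = TensorProduct.mk R S M 1 '' Set.range x := by
      ext z
      simp only [hy_def, Set.mem_range, Set.mem_image, TensorProduct.mk_apply, exists_exists_eq_and]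
    rw [hr]
    exact h.symm
  -- upstairs: Fitting ideals from the relations coming from downstairs
  let Kset : Set (Fin n → S) :=
    (fun κ : Fin n → R => fun l => algebraMap R S (κ l)) '' {κ | ∑ l, κ l • x l = 0}
  have hup := Module.fittingIdeal_eq_span_det_of_relations (R := S) y hy Kset
    (by
      rintro _ ⟨κ, hκ, rfl⟩
      exact Module.isRelation_baseChange S x hκ)
    (fun ρ' hρ' => Module.relation_baseChange_mem_span S x hx hρ') k
  rw [hup, Module.fittingIdeal_eq_relMinorIdeal x hx k]
  apply le_antisymm
  · refine Ideal.span_le.2 ?_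
    rintro d ⟨κ', σ, hκ', rfl⟩
    -- each row `κ' i` is the image of a relation `κ i` of `x`
    choose κ hκ hκκ' using hκ'
    have hdet : Matrix.det (Matrix.of fun i i' => κ' i (σ i')) =
        algebraMap R S (Matrix.det (Matrix.of fun i i' => κ i (σ i'))) := by
      rw [RingHom.map_det]
      congr 1
      ext i i'
      simp only [RingHom.mapMatrix_apply, Matrix.map_apply, Matrix.of_apply, ← hκκ' i]
    rw [SetLike.mem_coe, hdet]
    exact Ideal.mem_map_of_mem _ (Module.det_mem_relMinorIdeal x κ hκ σ)
  · rw [Ideal.map_le_iff_le_comap, Module.relMinorIdeal_le_iff]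
    intro κ σ hκ
    rw [Ideal.mem_comap, RingHom.map_det]
    refine Ideal.subset_span ⟨fun i l => algebraMap R S (κ i l), σ,
      fun i => ⟨κ i, hκ i, rfl⟩, ?_⟩
    congr 1

end BaseChange

end Literature.RingTheory.FittingIdeal
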